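/-
Copyright: b2b-lace packet (lean typing seat 1, gen 43).  [FvdH17] §3.4 "Split for N = 1" and §6.1 proof of Lemma 5.1,
piece D1 of the `(0,0)`-square device for `Ξ^{(1)}_R` (node N76-XIR1-DEVICE): the `u = 0` cylinder split of the two-level
`N = 1` coefficient at EVENT level, the extracted part identified with the landed `Ξ^{(1)}_α = nobleXiA1T`, and the
coding/union bound of [FvdH17] (4.65) carrying the level-`0` cylinder.  Proofs only; no named fact; no numeral; no dimension.
-/
import Literature.Probability.FitznerVanDerHofstad2017.NobleJointTwoLevel
import Literature.Probability.FitznerVanDerHofstad2017.NoblePercolationSplit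
import Literature.Probability.FitznerVanDerHofstad2017.NoblePercLetters
import HarnessLib

/-!
# [FvdH17] §3.4 / §6.1 — the `u = 0` cylinder split of `Ξ^{(1)}` and `Ξ^{(1)}_α` at event level

Source: R. Fitzner, R. van der Hofstad, *Mean-field behavior for nearest-neighbor percolation in `d > 10`*, Electron.
J. Probab. **22** (2017) no. 43 [FitznerVanDerHofstad2017], arXiv:1506.07977v2: §3.4 "Split for N = 1" (p. 31: `Ξ^{(1)}_α`
= the part of `Ξ^{(1)}` in which the first cutting bond is `b̲₀ = 0` and `(0,x)` is occupied at level `0`; landed as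
`NoblePercolationSplit.nobleXiA1T` with `xiA (.iter 1) = (nobleXiA1T …).toReal`), (4.65) and §4.4 (p. 43: the bounding
events of the two-level coefficient, landed as `NobleJointTwoLevel.twoLevel` / `jointWit` with
`nobleXiT_one_eq_tsum_prod` and `prod_twoLevel_le_tsum_pi_jointWit`), and §6.1, proof of Lemma 5.1 (p. 60,
(Bound-Xi-case-abZero-split): "we use `b̲ = 0` … If `b = (0,x)` is vacant then `0` has to be connected to `x` with a
path of length at least 2").

## What this module proves (kernel-checked; no cited hypothesis; no dimension, no numerical value)

For bond percolation on `ℤ^d` (any `d`, any `p`), with `ℙ ⊗ ℙ` the product of the two independent levels: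

* `prod_twoLevel_origin_inter_cyl`: `(ℙ⊗ℙ)(twoLevel (0,v) x ∩ {(0,x) ∈ ω₀})` is the `e = v` integrand of
  `nobleXiA1T d p x` (Fubini slice through the level-`0` cylinder, as in `nobleXiT_one_eq_tsum_prod`);
* `tsum_prod_twoLevel_origin_inter_cyl`: summed against `J(v)`, it IS `nobleXiA1T d p x` for `0 ∼ x`;
* **`nobleXiT_one_le_nobleXiA1T_add`**: for `0 ∼ x`,
  `Ξ^{(1)}(x) ≤ Ξ^{(1)}_α(x) + Σ_{b₀} J(b₀) (ℙ⊗ℙ)(twoLevel b₀ x ∩ {b̲₀ = 0 → (0,x) vacant at level 0})`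
  — the split of [FvdH17] §3.4 at event level (the closed part is what §6.1 p. 60 bounds with the longer loop);
* `prod_twoLevel_inter_le_tsum_pi_jointWit_inter`: the union bound over the coding `(w,z,t)` of (4.65) with an
  arbitrary measurable level-`0` cylinder carried along (proof of `prod_twoLevel_le_tsum_pi_jointWit` verbatim);
* `tsum_closed_le_tsum_pi_jointWit_closed`: hence the closed part is bounded by
  `Σ_{b₀,w,z,t} J(b₀) ℙ^{⊗2}(jointWit b₀ w z t x ∩ {b̲₀ = 0 → (0,x) ∉ ω 0})` — the `h1`-input shape of
  `NobleBoundsN1Classes.le_tsum_blocks_of_pointwise` for the closed part.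

The class-`(0,0)` cell with the direct bond vacant (`𝓣_{1̲,1,2}`, `NobleBoundsN1Class00OffBond`) and the one-member
extraction `Σ_x Ξ^C + Bubble₃ ≤ P⃗^S Ā' P⃗^E + Bubble₄` are separate modules.  Nothing landed is modified; no `def`.
-/

namespace Literature.Probability.FitznerVanDerHofstad2017

open MeasureTheory Literature.Barriers.CriticalPhenomena Literature.Probability.Percolation
open Literature.Probability.LatticeModels Literature.Probability.FitznerVanDerHofstad2017.NobleBlocks
open scoped ENNReal BigOperators

variable {d : ℕ}

/-- The `u = 0` two-level event through the level-`0` cylinder `{(0,x) occupied}` has product measure equal to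
the `e = v` integrand of `Ξ^{(1)}_α(x)`. [cite: FitznerVanDerHofstad2017, §3.4 definition of Ξ^{(1)}_α (arXiv:1506.07977v2 p. 31); (3.31), (3.43) (pp. 27–28)] -/
theorem prod_twoLevel_origin_inter_cyl (p : unitInterval) (v x : Site d) :
    ((bondPercolation (zdGraph d) p).prod (bondPercolation (zdGraph d) p))
        (twoLevel 0 v x ∩ {q | s((0 : Site d), x) ∈ q.1}) =
      ∫⁻ ω, {ω : BondConfig (Site d) | v ∉ restrCluster 0 v 0 ω ∧ s((0 : Site d), x) ∈ ω}.indicator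
        (fun ω => nobleKerXi d p 0 (restrCluster 0 v 0 ω) v x) ω ∂(bondPercolation (zdGraph d) p) := by
  classical
  have hm : MeasurableSet (twoLevel 0 v x ∩ {q : BondConfig (Site d) × BondConfig (Site d) |
      s((0 : Site d), x) ∈ q.1}) :=
    (measurableSet_twoLevel 0 v x).inter ((measurableSet_mem _).preimage measurable_fst)
  rw [Measure.prod_apply hm]
  refine lintegral_congr fun ω => ?_
  by_cases hω : ω ∈ {ω : BondConfig (Site d) | v ∉ restrCluster 0 v 0 ω ∧ s((0 : Site d), x) ∈ ω}
  · rw [Set.indicator_of_mem hω, nobleKerXi_apply, probOff_def]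
    congr 1
    ext ω₁
    simp only [mem_occursOff_iff, Set.mem_preimage, Set.mem_inter_iff, twoLevel, Set.mem_setOf_eq,
      offBonds_empty, Set.union_empty]
    exact ⟨fun h => h.1.2, fun h => ⟨⟨(mem_nobleCell_origin_iff v ω).2 hω.1, h⟩, hω.2⟩⟩
  · rw [Set.indicator_of_notMem hω]
    have he : Prod.mk ω ⁻¹' (twoLevel 0 v x ∩ {q : BondConfig (Site d) × BondConfig (Site d) |
        s((0 : Site d), x) ∈ q.1}) = ∅ :=
      Set.eq_empty_iff_forall_notMem.2 fun ω₁ h => hω ⟨(mem_nobleCell_origin_iff v ω).1 h.1.1, h.2⟩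
    rw [he, measure_empty]

/-- **`Σ_v J(v)·(ℙ⊗ℙ)(twoLevel (0,v) x ∩ {(0,x) occ.}) = Ξ^{(1)}_α(x)`** for `0 ∼ x`.
[cite: FitznerVanDerHofstad2017, §3.4 definition of Ξ^{(1)}_α (arXiv:1506.07977v2 p. 31)] -/
theorem tsum_prod_twoLevel_origin_inter_cyl (p : unitInterval) {x : Site d} (hx : (zdGraph d).Adj 0 x) :
    ∑' v, ENNReal.ofReal (bondJ d p v) *
        ((bondPercolation (zdGraph d) p).prod (bondPercolation (zdGraph d) p))
          (twoLevel 0 v x ∩ {q | s((0 : Site d), x) ∈ q.1}) = nobleXiA1T d p x := by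
  unfold nobleXiA1T
  rw [if_pos hx]
  exact tsum_congr fun v => by rw [prod_twoLevel_origin_inter_cyl]

/-- **The `(0,0)`-square extraction, event level** ([FvdH17] §6.1 p. 60): for `0 ∼ x`,
`Ξ^{(1)}(x) ≤ Ξ^{(1)}_α(x) + Σ_{b₀} J(b₀)·(ℙ⊗ℙ)(twoLevel b₀ x ∩ {b̲₀ = 0 → (0,x) vacant at level 0})`.
[cite: FitznerVanDerHofstad2017, §6.1 proof of Lemma 5.1, (Bound-Xi-case-abZero-split) (arXiv:1506.07977v2 p. 60); §3.4 (p. 31)] -/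
theorem nobleXiT_one_le_nobleXiA1T_add (p : unitInterval) {x : Site d} (hx : (zdGraph d).Adj 0 x) :
    nobleXiT d p 1 x ≤ nobleXiA1T d p x +
      ∑' b : Site d × Site d, ENNReal.ofReal (bondJ d p (b.2 - b.1)) *
        ((bondPercolation (zdGraph d) p).prod (bondPercolation (zdGraph d) p))
          (twoLevel b.1 b.2 x ∩ {q | b.1 = 0 → s((0 : Site d), x) ∉ q.1}) := by
  classical
  rw [nobleXiT_one_eq_tsum_prod, ← tsum_prod_twoLevel_origin_inter_cyl p hx]
  have key : ∀ b : Site d × Site d, ENNReal.ofReal (bondJ d p (b.2 - b.1)) *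
      ((bondPercolation (zdGraph d) p).prod (bondPercolation (zdGraph d) p)) (twoLevel b.1 b.2 x) ≤
      (if b.1 = 0 then ENNReal.ofReal (bondJ d p b.2) *
          ((bondPercolation (zdGraph d) p).prod (bondPercolation (zdGraph d) p))
            (twoLevel 0 b.2 x ∩ {q | s((0 : Site d), x) ∈ q.1}) else 0) +
        ENNReal.ofReal (bondJ d p (b.2 - b.1)) *
          ((bondPercolation (zdGraph d) p).prod (bondPercolation (zdGraph d) p))
            (twoLevel b.1 b.2 x ∩ {q | b.1 = 0 → s((0 : Site d), x) ∉ q.1}) := by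
    rintro ⟨u, v⟩
    by_cases hb : u = 0
    · subst hb
      rw [if_pos rfl, sub_zero, ← mul_add]
      refine mul_le_mul' le_rfl ?_
      refine (measure_mono fun q hq => ?_).trans (measure_union_le _ _)
      by_cases h : s((0 : Site d), x) ∈ q.1
      · exact Or.inl ⟨hq, h⟩
      · exact Or.inr ⟨hq, fun _ => h⟩
    · rw [if_neg hb, zero_add]
      exact mul_le_mul' le_rfl (measure_mono fun q hq => ⟨hq, fun h => absurd h hb⟩)
  refine (ENNReal.tsum_le_tsum key).trans (le_of_eq ?_)
  rw [ENNReal.tsum_add]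
  congr 1
  rw [ENNReal.tsum_prod']
  have hin : ∀ u : Site d, (∑' v : Site d, (if u = 0 then ENNReal.ofReal (bondJ d p v) *
      ((bondPercolation (zdGraph d) p).prod (bondPercolation (zdGraph d) p))
        (twoLevel 0 v x ∩ {q | s((0 : Site d), x) ∈ q.1}) else 0)) =
      if u = 0 then ∑' v : Site d, ENNReal.ofReal (bondJ d p v) *
        ((bondPercolation (zdGraph d) p).prod (bondPercolation (zdGraph d) p))
          (twoLevel 0 v x ∩ {q | s((0 : Site d), x) ∈ q.1}) else 0 := by
    intro u
    split_ifs <;> simp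
  simp_rw [hin]
  exact tsum_ite_eq 0 _

/-- **The union bound over the coding with a level-`0` cylinder carried along**: for a bond `b₀ = (u,v)` and a
measurable level-`0` event `C`, `(ℙ⊗ℙ)(twoLevel b₀ x ∩ {q | q.1 ∈ C}) ≤ Σ_{w,z,t} ℙ^{⊗2}(jointWit b₀ w z t x ∩ {ω | ω 0 ∈ C})`
(the proof of `prod_twoLevel_le_tsum_pi_jointWit` verbatim; the cylinder does not interact with the coding).
[cite: FitznerVanDerHofstad2017, (4.65) and §4.4 after (4.65) (arXiv:1506.07977v2 p. 43)] -/
theorem prod_twoLevel_inter_le_tsum_pi_jointWit_inter (p : unitInterval) {u v : Site d} (huv : u ≠ v)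
    (x : Site d) {C : Set (BondConfig (Site d))} (hC : MeasurableSet C) :
    ((bondPercolation (zdGraph d) p).prod (bondPercolation (zdGraph d) p)) (twoLevel u v x ∩ {q | q.1 ∈ C}) ≤
      ∑' w : Site d, ∑' z : Site d, ∑' t : Site d,
        Measure.pi (fun _ : Fin 2 => bondPercolation (zdGraph d) p) (jointWit u v w z t x ∩ {ω | ω 0 ∈ C}) := by
  set P := bondPercolation (zdGraph d) p with hP
  set N : Set (BondConfig (Site d)) := {ω | ¬ ω ⊆ (zdGraph d).edgeSet} with hN
  have hN0 : P N = 0 := measure_not_subset_edgeSet p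
  have hsub : twoLevel u v x ∩ {q | q.1 ∈ C} ⊆
      (⋃ w : Site d, ⋃ z : Site d, ⋃ t : Site d,
          {q : BondConfig (Site d) × BondConfig (Site d) |
            ![q.1, q.2] ∈ jointWit u v w z t x ∩ {ω | ω 0 ∈ C}}) ∪
        (N ×ˢ Set.univ ∪ Set.univ ×ˢ N) := by
    rintro ⟨ω₀, ω₁⟩ ⟨⟨hcell, hE⟩, hq⟩
    by_cases h₀ : ω₀ ⊆ (zdGraph d).edgeSet
    · by_cases h₁ : ω₁ ⊆ (zdGraph d).edgeSet
      · left
        obtain ⟨w, z, t, h⟩ := exists_mem_jointWit h₀ h₁ huv hcell hE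
        simp only [Set.mem_iUnion, Set.mem_setOf_eq, Set.mem_inter_iff]
        exact ⟨w, z, t, h, hq⟩
      · exact Or.inr (Or.inr ⟨Set.mem_univ _, h₁⟩)
    · exact Or.inr (Or.inl ⟨h₀, Set.mem_univ _⟩)
  calc (P.prod P) (twoLevel u v x ∩ {q | q.1 ∈ C})
      ≤ (P.prod P) ((⋃ w : Site d, ⋃ z : Site d, ⋃ t : Site d,
            {q : BondConfig (Site d) × BondConfig (Site d) |
              ![q.1, q.2] ∈ jointWit u v w z t x ∩ {ω | ω 0 ∈ C}}) ∪
          (N ×ˢ Set.univ ∪ Set.univ ×ˢ N)) := measure_mono hsub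
    _ ≤ (P.prod P) (⋃ w : Site d, ⋃ z : Site d, ⋃ t : Site d,
            {q : BondConfig (Site d) × BondConfig (Site d) |
              ![q.1, q.2] ∈ jointWit u v w z t x ∩ {ω | ω 0 ∈ C}}) +
          (P.prod P) (N ×ˢ Set.univ ∪ Set.univ ×ˢ N) := measure_union_le _ _
    _ = (P.prod P) (⋃ w : Site d, ⋃ z : Site d, ⋃ t : Site d,
            {q : BondConfig (Site d) × BondConfig (Site d) |
              ![q.1, q.2] ∈ jointWit u v w z t x ∩ {ω | ω 0 ∈ C}}) := by
        have h0 : (P.prod P) (N ×ˢ Set.univ ∪ Set.univ ×ˢ N) = 0 := by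
          refine le_antisymm ((measure_union_le _ _).trans ?_) bot_le
          rw [Measure.prod_prod, Measure.prod_prod, hN0, zero_mul, mul_zero, add_zero]
        rw [h0, add_zero]
    _ ≤ ∑' w : Site d, (P.prod P) (⋃ z : Site d, ⋃ t : Site d,
            {q : BondConfig (Site d) × BondConfig (Site d) |
              ![q.1, q.2] ∈ jointWit u v w z t x ∩ {ω | ω 0 ∈ C}}) :=
        measure_iUnion_le _
    _ ≤ ∑' w : Site d, ∑' z : Site d, (P.prod P) (⋃ t : Site d,
            {q : BondConfig (Site d) × BondConfig (Site d) |
              ![q.1, q.2] ∈ jointWit u v w z t x ∩ {ω | ω 0 ∈ C}}) :=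
        ENNReal.tsum_le_tsum fun w => measure_iUnion_le _
    _ ≤ ∑' w : Site d, ∑' z : Site d, ∑' t : Site d, (P.prod P)
            {q : BondConfig (Site d) × BondConfig (Site d) |
              ![q.1, q.2] ∈ jointWit u v w z t x ∩ {ω | ω 0 ∈ C}} :=
        ENNReal.tsum_le_tsum fun w => ENNReal.tsum_le_tsum fun z => measure_iUnion_le _
    _ = ∑' w : Site d, ∑' z : Site d, ∑' t : Site d,
          Measure.pi (fun _ : Fin 2 => P) (jointWit u v w z t x ∩ {ω | ω 0 ∈ C}) := by
        refine tsum_congr fun w => tsum_congr fun z => tsum_congr fun t => ?_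
        rw [pi_two_eq_prod_setOf P (S := jointWit u v w z t x ∩ {ω | ω 0 ∈ C})
          ((measurableSet_jointWit u v w z t x).inter (hC.preimage (measurable_pi_apply 0)))]

/-- **`h1` for the closed part `Ξ^C`**: `Σ_{b₀} J(b₀)(ℙ⊗ℙ)(twoLevel b₀ x ∩ {b̲₀ = 0 → (0,x) vacant}) ≤
Σ_{b₀,w,z,t} J(b₀) ℙ^{⊗2}(jointWit b₀ w z t x ∩ {ω | b̲₀ = 0 → (0,x) ∉ ω 0})` — the input shape of
`NobleBoundsN1Classes.nobleXiT_one_le_blocks_of_cls` with `E u v w z t := jointWit u v w z t x ∩ {ω | u = 0 → s(0,x) ∉ ω 0}`.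
[cite: FitznerVanDerHofstad2017, (4.65) (arXiv:1506.07977v2 p. 43); §6.1 p. 60] -/
theorem tsum_closed_le_tsum_pi_jointWit_closed (p : unitInterval) (x : Site d) :
    ∑' b : Site d × Site d, ENNReal.ofReal (bondJ d p (b.2 - b.1)) *
        ((bondPercolation (zdGraph d) p).prod (bondPercolation (zdGraph d) p))
          (twoLevel b.1 b.2 x ∩ {q | b.1 = 0 → s((0 : Site d), x) ∉ q.1}) ≤
      ∑' b : Site d × Site d, ∑' w : Site d, ∑' z : Site d, ∑' t : Site d,
        ENNReal.ofReal (bondJ d p (b.2 - b.1)) *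
          piPerc d p 2 (jointWit b.1 b.2 w z t x ∩ {ω | b.1 = 0 → s((0 : Site d), x) ∉ ω 0}) := by
  refine ENNReal.tsum_le_tsum fun b => ?_
  simp_rw [ENNReal.tsum_mul_left]
  by_cases hb : b.1 = b.2
  · have hJ : bondJ d p (b.2 - b.1) = 0 := by
      rw [hb, sub_self, bondJ_def, if_neg (SimpleGraph.irrefl _)]
    rw [hJ, ENNReal.ofReal_zero, zero_mul, zero_mul]
  · refine mul_le_mul' le_rfl ?_
    have hC : MeasurableSet {ω : BondConfig (Site d) | b.1 = 0 → s((0 : Site d), x) ∉ ω} := by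
      by_cases h0 : b.1 = 0
      · simp only [h0, true_implies]
        exact (measurableSet_mem _).compl
      · simp only [h0, false_implies, Set.setOf_true]
        exact MeasurableSet.univ
    exact prod_twoLevel_inter_le_tsum_pi_jointWit_inter p hb x hC

end Literature.Probability.FitznerVanDerHofstad2017
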